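import Literature.AlgebraicGeometry.HodgeTheory.GoursatKolchinRibetHolds
import HarnessLib

/-!
# Goursat–Kolchin–Ribet: the lift form (1) follows from the projection form (1′) — the UNPRIMED fact
# `Katz1990_goursatKolchinRibet_specialLinear` from the primed one, hence from `Aut 𝔰𝔩ₙ` (Katz 1990, Prop. 1.8.2;
# Springer 2.2.5 (iv) `φ(G°) ⊆ (φG)°`)

Layer `Literature/AlgebraicGeometry/HodgeTheory` (companion of `GoursatKolchinRibetProjections`, which proves
the converse `Katz1990_goursatKolchinRibet_specialLinear → Katz1990_goursatKolchinRibet_specialLinear'`). THEOREMS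
only. The unprimed fact renders Katz's hypothesis (1) in LIFT form («every `u ∈ SL(Eᵢ)` is the `i`-th block of an
element of `G° = glIdentityComponent (H.map blockDiagHom)`»); the primed fact in PROJECTION form
(«`SL(Eᵢ) ⊆ ((ρᵢ H)^Zar)° = glIdentityComponent (H.map ρᵢ)`»). The lift form implies the projection form because the
`i`-th block of an element of `G°` lies in `((ρᵢ H)^Zar)°` — the easy inclusion `ρᵢ(G°) ⊆ (ρᵢ G)°` of Springer
2.2.5 (iv) (`GlZariskiClosureImage.map_mem_glIdentityComponent_map`, for the polynomial block projection of
`GoursatKolchinRibetProjections`). So: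

* `eval_mem_glIdentityComponent_map_of_blockDiagHom_mem` — `blockDiagHom s ∈ G° ⇒ sᵢ ∈ ((ρᵢ H)^Zar)°`;
* `Katz1990_goursatKolchinRibet_specialLinear_of_specialLinear'` — the two Katz facts are EQUIVALENT;
* `Katz1990_goursatKolchinRibet_specialLinear_of_jacobson` — the unprimed fact modulo
  `Jacobson1962_sl_automorphisms` (via `GoursatKolchinRibetHolds`).

Crux K1 of `Summits/HodgeConjecture/HodgeConjecture/Theses/CyclicUnitaryPowers.lean` (cell `hodge-nonav`); written by
the prover seat `hodge-nonav-prover-Ax`.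

## References
* [Katz1990ESDE] N. M. Katz, *Exponential Sums and Differential Equations* (1990), §1.8 Prop. 1.8.2.
* [SpringerLAG1998] T. A. Springer, *Linear Algebraic Groups*, 2nd ed. (1998), 2.2.5 (iv).
-/

noncomputable section

open Module Literature.AlgebraicGeometry.Motives

namespace Literature.AlgebraicGeometry.HodgeTheory

universe u v

variable {ι : Type u} [Fintype ι] [DecidableEq ι] {E : ι → Type v} [∀ i, AddCommGroup (E i)]
  [∀ i, Module ℂ (E i)] [∀ i, FiniteDimensional ℂ (E i)]

/-- **`ρᵢ(G°) ⊆ (Gᵢ)°`** (Springer 2.2.5 (iv), the easy inclusion `φ(G°) ⊆ (φG)°`; Katz: "`G°` maps onto each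
`Gᵢ°`"): for `H ≤ Πⱼ GL(Eⱼ)` and a block-diagonal family `s` with `blockDiagHom s ∈ glIdentityComponent (H.map blockDiagHom)`,
the `i`-th block `sᵢ` lies in `glIdentityComponent (H.map ρᵢ)`. The block projection `Δ^Zar → GL(Eᵢ)` is the polynomial
homomorphism of `GoursatKolchinRibetProjections` (matrix = the `(i,i)` block of the generic matrix) carrying `Δ` onto
`ρᵢ H`; apply `GlZariskiClosureImage.map_mem_glIdentityComponent_map`. [cite: SpringerLAG1998, 2.2.5 (iv)]
[cite: Katz1990ESDE, §1.8 Prop. 1.8.2 (proof)] -/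
theorem eval_mem_glIdentityComponent_map_of_blockDiagHom_mem (H : Subgroup (Π j, (E j ≃ₗ[ℂ] E j))) (i : ι)
    {s : Π j, (E j ≃ₗ[ℂ] E j)} (hs : blockDiagHom E s ∈ glIdentityComponent (H.map (blockDiagHom E))) :
    s i ∈ glIdentityComponent (H.map (Pi.evalMonoidHom (fun j => E j ≃ₗ[ℂ] E j) i)) := by
  classical
  -- adapted from GoursatKolchinRibetProjections.exists_blockDiagHom_mem_glIdentityComponent_of_mem (same projection,
  -- opposite inclusion of Springer 2.2.5 (iv))
  let b : ∀ j, Module.Basis (Fin (finrank ℂ (E j))) ℂ (E j) := fun j => Module.finBasis ℂ (E j)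
  let B := Pi.basis b
  set Δ : Subgroup ((Π j, E j) ≃ₗ[ℂ] (Π j, E j)) := H.map (blockDiagHom E) with hΔ
  have hex : ∀ g : glZariskiClosureSubgroup Δ, ∃ s : Π j, (E j ≃ₗ[ℂ] E j), blockDiagHom E s = g := fun g =>
    exists_eq_blockDiagHom_of_mem_glZariskiClosure H g.2
  choose σ hσ using hex
  have hσ_blockDiag : ∀ (h : Π j, (E j ≃ₗ[ℂ] E j)) (hh : blockDiagHom E h ∈ glZariskiClosureSubgroup Δ),
      σ ⟨blockDiagHom E h, hh⟩ = h := fun h hh => blockDiagHom_injective E (hσ ⟨blockDiagHom E h, hh⟩)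
  let σh : glZariskiClosureSubgroup Δ →* (Π j, (E j ≃ₗ[ℂ] E j)) :=
    { toFun := σ
      map_one' := blockDiagHom_injective E (by rw [hσ, map_one]; rfl)
      map_mul' := fun x y => blockDiagHom_injective E (by rw [map_mul, hσ, hσ, hσ]; rfl) }
  let φ : glZariskiClosureSubgroup Δ →* (E i ≃ₗ[ℂ] E i) := (Pi.evalMonoidHom (fun j => E j ≃ₗ[ℂ] E j) i).comp σh
  have hφ_apply : ∀ g : glZariskiClosureSubgroup Δ, φ g = σ g i := fun g => rfl
  have hφ : ∀ g : glZariskiClosureSubgroup Δ,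
      LinearMap.toMatrix (b i) (b i) ((φ g : E i ≃ₗ[ℂ] E i) : E i →ₗ[ℂ] E i) =
        (evalAtInvDet (LinearMap.toMatrix B B ((g : (Π j, E j) ≃ₗ[ℂ] (Π j, E j)) : Module.End ℂ (Π j, E j)))).mapMatrix
          (Matrix.of fun k l : Fin (finrank ℂ (E i)) =>
            (Polynomial.C (MvPolynomial.X ((⟨i, k⟩ : Σ j, Fin (finrank ℂ (E j))), (⟨i, l⟩ : Σ j, Fin (finrank ℂ (E j))))) :
              Polynomial (MvPolynomial ((Σ j, Fin (finrank ℂ (E j))) × (Σ j, Fin (finrank ℂ (E j)))) ℂ))) := by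
    intro g
    ext k l
    rw [RingHom.mapMatrix_apply, Matrix.map_apply, Matrix.of_apply, evalAtInvDet_C, MvPolynomial.eval_X, hφ_apply]
    conv_rhs => rw [← hσ g, toMatrix_blockDiagHom, Matrix.blockDiagonal'_apply_eq]
  have himage : (Δ.subgroupOf (glZariskiClosureSubgroup Δ)).map φ = H.map (Pi.evalMonoidHom (fun j => E j ≃ₗ[ℂ] E j) i) := by
    ext v
    constructor
    · rintro ⟨g, hg, rfl⟩
      obtain ⟨h, hh, hhg⟩ := Subgroup.mem_map.1 (Subgroup.mem_subgroupOf.1 hg)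
      refine ⟨h, hh, ?_⟩
      rw [Pi.evalMonoidHom_apply, hφ_apply]
      have : σ g = h := blockDiagHom_injective E (by rw [hσ, hhg])
      rw [this]
    · rintro ⟨h, hh, rfl⟩
      have hmem : blockDiagHom E h ∈ glZariskiClosureSubgroup Δ :=
        le_glZariskiClosureSubgroup Δ (Subgroup.mem_map_of_mem _ hh)
      refine ⟨⟨blockDiagHom E h, hmem⟩, Subgroup.mem_subgroupOf.2 (Subgroup.mem_map_of_mem _ hh), ?_⟩
      rw [hφ_apply, hσ_blockDiag h hmem, Pi.evalMonoidHom_apply]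
  have hsZ : blockDiagHom E s ∈ glZariskiClosureSubgroup Δ :=
    (mem_glZariskiClosureSubgroup_iff _ _).2 (glIdentityComponent_subset_glZariskiClosure _ hs)
  have h := map_mem_glIdentityComponent_map B (b i) Δ φ _ hφ ⟨blockDiagHom E s, hsZ⟩ hs
  rw [himage, hφ_apply, hσ_blockDiag s hsZ] at h
  exact h

/-- **The unprimed Katz fact follows from the primed one** (so, with
`GoursatKolchinRibetProjections.Katz1990_goursatKolchinRibet_specialLinear'_of_specialLinear`, the two renderings are
equivalent): the lift form of hypothesis (1) gives the projection form by
`eval_mem_glIdentityComponent_map_of_blockDiagHom_mem`; (3), (4) and the conclusion agree.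
[cite: Katz1990ESDE, §1.8 Prop. 1.8.2] [cite: SpringerLAG1998, 2.2.5 (iv)] -/
theorem Katz1990_goursatKolchinRibet_specialLinear_of_specialLinear'
    (hK : Katz1990_goursatKolchinRibet_specialLinear') : Katz1990_goursatKolchinRibet_specialLinear := by
  intro ι _ hι E _ _ _ hE H h1 h3 h4 u hu
  classical
  refine hK ι hι E hE H (fun i v hv => ?_) h3 h4 u hu
  obtain ⟨s, hs, hsi⟩ := h1 i v hv
  rw [← hsi]
  exact eval_mem_glIdentityComponent_map_of_blockDiagHom_mem H i hs

/-- **The unprimed Goursat–Kolchin–Ribet criterion `Katz1990_goursatKolchinRibet_specialLinear` modulo the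
classification of `Aut 𝔰𝔩ₙ(ℂ)`** (`Jacobson1962_sl_automorphisms`). [cite: Katz1990ESDE, §1.8 Prop. 1.8.2]
[cite: Jacobson1962LieAlgebras, Ch. IX §5 Theorem 5 (p. 283)] -/
theorem Katz1990_goursatKolchinRibet_specialLinear_of_jacobson
    (hJ : Literature.Algebra.Lie.SpecialLinearAutomorphisms.Jacobson1962_sl_automorphisms.{0, 0}) :
    Katz1990_goursatKolchinRibet_specialLinear :=
  Katz1990_goursatKolchinRibet_specialLinear_of_specialLinear' (Katz1990_goursatKolchinRibet_specialLinear'_of_jacobson hJ)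

end Literature.AlgebraicGeometry.HodgeTheory

end
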